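import Literature.AlgebraicGeometry.Motives.ProductChartStalks
import Literature.AlgebraicGeometry.Motives.ShearCocycleFactorisation
import Literature.AlgebraicGeometry.Motives.RatFnSectionRestriction
import Literature.AlgebraicGeometry.Motives.FunctionFieldProductRelativeBasis
import Literature.AlgebraicGeometry.Smoothening.SmoothAffineChartKaehlerBasis
import Literature.AlgebraicGeometry.GroupSchemes.GrpObjShear
import Literature.RingTheory.Localization.KaehlerBaseLocalization
import HarnessLib

/-!
# A smooth group scheme over a field carries a rational top form which is a frame at every point

Topic `Literature/AlgebraicGeometry/Motives` (proofs only; no definitions, no named facts), in the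
rational currency of ★ `RationalTopFormFrames` / ★ `RelativeLocalCoordinates` (a rational top form is
a pair `(f₀, y)`: `f₀ ∈ K(E)`, rational coordinates `y` with `d yᵢ` a basis `B₀` of `Ω[K(E)⁄K]`; «frame
at `p` for local coordinates `z`» := `RatFn.IsUnitAt p (f₀ · B_z.det B₀)`).

* `exists_topForm_frame_of_grpObj` — **the invariant volume form** (Bosch–Lütkebohmert–Raynaud,
  *Néron Models*, §4.2 Prop. 1 and 2, existence part, in rational currency): a smooth group scheme
  `E → Spec K` over a field (with `E`, `E ×_K E` integral) carries a rational top form which is a frame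
  at EVERY point for EVERY system of local coordinates (`𝒪_{E,p}` a `K`-algebra through ★ `stalkHom`).
  Construction with honest global morphisms of `E ×_K E`: `θ₀ := d y₁ ∧ … ∧ d yₙ` for chart
  coordinates at the unit point `ε` (★ `Smoothening.exists_affineChart_basis_eq_D`); its shear cocycle
  `c₀ ∈ K(E × E)` along `Φ = (pr₁, m)` (★ `GroupSchemes.isIso_lift_fst_mul`), computed at the points
  `s p = (p, ε)` with the relative coordinates of ★ `exists_basis_stalk_tensorObj_eq_D` and factorised
  by ★ `det_shearCocycle_eq_mul` as (unit at `(p, ε)`) · `m♯`(Jacobian at `p`), read canonically in the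
  `K(E)`-relative basis of ★ `exists_basis_kaehler_functionField_tensorObj`; restriction along the
  section `s = (id, ε)` of `m` (★ `RatFn.isUnitAt_inv_stalkMap_mul`) gives `g₀ := s♯ c₀` with
  `θ₀ / g₀` a frame at every `p`; independence of the coordinates by
  ★ `isUnitAt_mul_det_iff_of_localCoordinates'`.
* Plumbing: `germ_comp_appLE_eq_stalkHom`, `toFunctionField_comp_stalkHom` (the structure maps
  `K → Γ(E, V) → 𝒪_{E,x} → K(E)`), `exists_basis_stalk_of_chart'` / `exists_basis_functionField_of_chart'`
  (chart coordinates are local / rational coordinates, explicit-algebra forms of ★ `RationalTopFormFrames`),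
  `stalkMap_comp_stalkMap_comp_germ_of_comp_eq` (stalk maps over a factor).

Cell `hodgecm-mathlib`, road W of `r₀` ((W0) leaf L4a'-ASM part (A), E-side: B-p18's `W0-CORE-SPEC`
§3 with the model ↔ generic-fibre seam moved to the statement; part (B) transports this to the smooth
proper model `𝒳`, target `stub_L4a'`).

## Sources

* S. Bosch, W. Lütkebohmert, M. Raynaud, *Néron Models*, Ergebnisse (3) 21, Springer 1990, §4.2
  Prop. 1–2 (invariant differential forms on group schemes), §2.2 Prop. 11. [BLRNeronModels1990]
* U. Görtz, T. Wedhorn, *Algebraic Geometry I: Schemes*, 2nd ed., Springer Spektrum 2020, (3.4)–(3.5),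
  Prop. 3.29. [GortzWedhorn2020]
-/

noncomputable section

universe u

namespace Literature.AlgebraicGeometry.Motives

open CategoryTheory Limits _root_.AlgebraicGeometry MonoidalCategory CartesianMonoidalCategory
open RatFn Literature.AlgebraicGeometry.Smoothening
open scoped MonObj CategoryTheory.Obj

/-! ### The `K`-algebra structures `stalkHom` on stalks and their compatibilities -/

section StalkHomLemmas

variable {K : Type u} [CommRing K] (E : Over (Spec (.of K)))

/-- The chart algebra structure `K → Γ(E, V)` (`Spec`-iso, then `appLE`) followed by the germ map at a
point `x ∈ V` is the structure map `stalkHom E x : K → 𝒪_{E,x}` (Görtz–Wedhorn I, (3.4)–(3.5):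
morphisms of `K`-schemes on sections and stalks). [cite: GortzWedhorn2020, (3.4)–(3.5)] -/
theorem germ_comp_appLE_eq_stalkHom (V : E.left.Opens) (x : E.left) (hx : x ∈ V) :
    (E.left.presheaf.germ V x hx).hom.comp
        ((Scheme.ΓSpecIso (.of K)).inv ≫ E.hom.appLE ⊤ V le_top).hom = stalkHom E x := by
  ext r
  simp only [stalkHom, globalHom, RingHom.coe_comp, Function.comp_apply, CommRingCat.hom_comp,
    Scheme.Hom.appLE]
  exact TopCat.Presheaf.germ_res_apply E.left.presheaf _ _ _ _

variable [IsIntegral E.left]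

/-- `K → 𝒪_{E,x} → K(E)` is `K → K(E)`: `toFunctionField x ∘ stalkHom E x = stalkHom E η`
(the rational function of a germ does not depend on the point; Görtz–Wedhorn I, Prop. 3.29 (2)).
[cite: GortzWedhorn2020, Prop. 3.29 (2)] -/
theorem toFunctionField_comp_stalkHom (x : E.left) :
    (toFunctionField x).comp (stalkHom E x) = stalkHom E (genericPoint E.left) := by
  ext r
  simp only [stalkHom, globalHom, RingHom.coe_comp, Function.comp_apply]
  exact toFunctionField_germ (U := ⊤) (x := x) trivial _

end StalkHomLemmas

/-! ### Chart coordinates are local coordinates (arbitrary base ring, explicit algebra structures) -/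

section ChartCoordinates

variable {k : Type u} [CommRing k] {X : Scheme.{u}} [IsIntegral X] (n : ℕ)
  {V : X.Opens} (hV : IsAffineOpen V) [Algebra k Γ(X, V)]

omit [IsIntegral X] in
include hV in
/-- **Chart coordinates are local coordinates** (explicit-algebra form of ★ `exists_basis_stalk_of_chart`):
an exact basis `d y₁, …, d yₙ` of `Ω[Γ(X, V)⁄k]` on an affine open `V` localises at `x ∈ V` to a basis
`d yᵢ` of `Ω[𝒪_{X,x}⁄k]`, for any `k`-algebra structure on `𝒪_{X,x}` through which `Γ(X, V) → 𝒪_{X,x}`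
is the germ map (`𝒪_{X,x} = Γ(V)_{𝔭_x}`; `Ω` commutes with localisation). [cite: BLRNeronModels1990, §2.2 Prop. 11] -/
theorem exists_basis_stalk_of_chart' {y : Fin n → Γ(X, V)}
    (bV : Module.Basis (Fin n) Γ(X, V) Ω[Γ(X, V)⁄k])
    (hbV : ∀ i, bV i = KaehlerDifferential.D k _ (y i)) {x : X} (hx : x ∈ V)
    [Algebra k (X.presheaf.stalk x)]
    (halg : algebraMap k (X.presheaf.stalk x) =
      (X.presheaf.germ V x hx).hom.comp (algebraMap k Γ(X, V))) :
    ∃ b : Module.Basis (Fin n) (X.presheaf.stalk x) Ω[X.presheaf.stalk x⁄k],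
      ∀ i, b i = KaehlerDifferential.D k _ (X.presheaf.germ V x hx (y i)) := by
  letI : Algebra Γ(X, V) (X.presheaf.stalk x) := (X.presheaf.germ V x hx).hom.toAlgebra
  haveI : IsScalarTower k Γ(X, V) (X.presheaf.stalk x) :=
    IsScalarTower.of_algebraMap_eq fun c => by rw [halg]; rfl
  haveI : IsLocalization.AtPrime (X.presheaf.stalk x) (hV.primeIdealOf ⟨x, hx⟩).asIdeal :=
    hV.isLocalization_stalk ⟨x, hx⟩
  exact exists_basis_kaehler_localization_eq_D (X.presheaf.stalk x)
    (hV.primeIdealOf ⟨x, hx⟩).asIdeal.primeCompl bV hbV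

include hV in
/-- **Chart coordinates give a basis of `Ω[K(X)⁄k]`** (explicit-algebra form of
★ `exists_basis_functionField_of_chart`): the images in `K(X) = Frac Γ(X, V)` of an exact basis
`d yᵢ` of `Ω[Γ(X, V)⁄k]` form a `K(X)`-basis of `Ω[K(X)⁄k]`, for any `k`-algebra structure on `K(X)`
through which `Γ(X, V) → K(X)` is the canonical map. [cite: BLRNeronModels1990, §2.2 Prop. 11] -/
theorem exists_basis_functionField_of_chart' [Nonempty V] {y : Fin n → Γ(X, V)}
    (bV : Module.Basis (Fin n) Γ(X, V) Ω[Γ(X, V)⁄k])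
    (hbV : ∀ i, bV i = KaehlerDifferential.D k _ (y i)) [Algebra k X.functionField]
    (halg : algebraMap k X.functionField =
      (algebraMap Γ(X, V) X.functionField).comp (algebraMap k Γ(X, V))) :
    ∃ B : Module.Basis (Fin n) X.functionField Ω[X.functionField⁄k],
      ∀ i, B i = KaehlerDifferential.D k _ (algebraMap Γ(X, V) X.functionField (y i)) := by
  haveI : IsScalarTower k Γ(X, V) X.functionField := IsScalarTower.of_algebraMap_eq' halg
  haveI := functionField_isFractionRing_of_isAffineOpen X V hV
  exact exists_basis_kaehler_localization_eq_D X.functionField (nonZeroDivisors Γ(X, V)) bV hbV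

end ChartCoordinates

/-! ### Germs and stalk maps along equal morphisms -/

section GermCongr

variable {X Y : Scheme.{u}}

/-- Germ-then-stalk-map along equal morphisms (private rewriting helper). [folklore] -/
private theorem germ_stalkMap_congr {f g : X ⟶ Y} (e : f = g) (U : Y.Opens) (x : X)
    (hf : f x ∈ U) (hg : g x ∈ U) :
    Y.presheaf.germ U (f x) hf ≫ f.stalkMap x = Y.presheaf.germ U (g x) hg ≫ g.stalkMap x := by
  subst e; rfl

/-- **Stalk maps over a factor.** If `Φ ≫ pr = pr` (`Φ` a morphism over `pr`), then at every `q` the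
`Γ(Z, V)`-algebra structures «germ at `pr q`, then `pr♯_q`» on `𝒪_{Y,q}` and on `𝒪_{Y,Φ q}` are
identified by `Φ♯_q` (Görtz–Wedhorn I, (3.4)–(3.5)). [cite: GortzWedhorn2020, (3.4)–(3.5)] -/
theorem stalkMap_comp_stalkMap_comp_germ_of_comp_eq {Z : Scheme.{u}} (Φ : Y ⟶ Y) (pr : Y ⟶ Z)
    (h : Φ ≫ pr = pr) (V : Z.Opens) (q : Y) (hq : pr q ∈ V) (hq' : pr (Φ q) ∈ V) :
    (Φ.stalkMap q).hom.comp (((pr.stalkMap (Φ q)).hom.comp (Z.presheaf.germ V (pr (Φ q)) hq').hom)) =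
      (pr.stalkMap q).hom.comp (Z.presheaf.germ V (pr q) hq).hom := by
  have e1 : Z.presheaf.germ V (pr (Φ q)) hq' ≫ pr.stalkMap (Φ q) ≫ Φ.stalkMap q =
      Z.presheaf.germ V (pr q) hq ≫ pr.stalkMap q := by
    rw [← Scheme.Hom.stalkMap_comp]
    exact germ_stalkMap_congr h V q hq' hq
  have e2 := congrArg (fun φ => φ.hom) e1
  simpa only [CommRingCat.hom_comp, RingHom.comp_assoc] using e2

end GermCongr

/-! ### The theorem -/

section GroupScheme

variable {K : Type u} [Field K] (E : Over (Spec (.of K))) [GrpObj E] (n : ℕ)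
  [SmoothOfRelativeDimension n E.hom] [IsIntegral E.left] [IsIntegral (E ⊗ E).left]
  [IsDominant (fst E E).left] [IsDominant (snd E E).left]

/-- **A smooth group scheme over a field has a rational top form which is a frame at every point**
(the invariant volume form; Bosch–Lütkebohmert–Raynaud, *Néron Models*, §4.2 Prop. 1 and 2, in the
rational currency of ★ `RationalTopFormFrames`): for `E → Spec K` a smooth group scheme of relative
dimension `n` with `E` and `E ×_K E` integral, there are `f₀ ∈ K(E)` and rational coordinates `y`
(`d yᵢ` a basis `B₀` of `Ω[K(E)⁄K]`) such that `θ = f₀ · d y₁ ∧ … ∧ d yₙ` is a frame at EVERY point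
`p ∈ E` for EVERY system of local coordinates `z` at `p` over `K` (`𝒪_{E,p}` a `K`-algebra through
★ `stalkHom`): `IsUnitAt p (f₀ · B_z.det B₀)`.  Construction: `θ₀ := d y₁ ∧ … ∧ d yₙ` for chart
coordinates `y` at the unit `ε`; its shear cocycle `c₀ ∈ K(E × E)` (★ `det_shearCocycle_eq_mul`,
relative coordinates from ★ `exists_basis_stalk_tensorObj_eq_D`) restricted along the section
`x ↦ (x, ε)` gives `g₀ ∈ K(E)` with `θ₀ / g₀` a frame everywhere (★ `isUnitAt_inv_stalkMap_mul`).
[cite: BLRNeronModels1990, §4.2 Prop. 1–2] -/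
theorem exists_topForm_frame_of_grpObj [Algebra K E.left.functionField]
    (hKL : algebraMap K E.left.functionField = stalkHom E (genericPoint E.left)) :
    ∃ (f₀ : E.left.functionField) (y : Fin n → E.left.functionField)
      (B₀ : Module.Basis (Fin n) E.left.functionField Ω[E.left.functionField⁄K]),
      (∀ i, B₀ i = KaehlerDifferential.D K _ (y i)) ∧
      ∀ (p : E.left) (z : Fin n → E.left.presheaf.stalk p)
        (b : letI := (stalkHom E p).toAlgebra
          Module.Basis (Fin n) (E.left.presheaf.stalk p) Ω[E.left.presheaf.stalk p⁄K])
        (_ : letI := (stalkHom E p).toAlgebra; ∀ i, b i = KaehlerDifferential.D K _ (z i))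
        (B : Module.Basis (Fin n) E.left.functionField Ω[E.left.functionField⁄K])
        (_ : ∀ i, B i = KaehlerDifferential.D K _ (toFunctionField p (z i))),
        IsUnitAt p (f₀ * B.det B₀) := by
  classical
  -- ### the morphisms: `Y = E × E`, shear `Φ`, projections, multiplication `μ'`, section `s`
  let Y : Scheme.{u} := (E ⊗ E).left
  let L := E.left.functionField
  let Φ : Y ⟶ Y := (lift (fst E E) μ[E]).left
  let pr₁ : Y ⟶ E.left := (fst E E).left
  let pr₂ : Y ⟶ E.left := (snd E E).left
  let μ' : Y ⟶ E.left := (μ[E]).left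
  let s : E.left ⟶ Y := (lift (𝟙 E) (toUnit E ≫ η[E])).left
  have hΦ₁ : Φ ≫ pr₁ = pr₁ := by
    change (lift (fst E E) μ[E] ≫ fst E E).left = (fst E E).left
    rw [lift_fst]
  have hΦ₂ : Φ ≫ pr₂ = μ' := by
    change (lift (fst E E) μ[E] ≫ snd E E).left = (μ[E]).left
    rw [lift_snd]
  have hs : s ≫ μ' = 𝟙 E.left := by
    change (lift (𝟙 E) (toUnit E ≫ η[E]) ≫ μ[E]).left = _
    rw [MonObj.lift_comp_one_right]
    rfl
  have hs₁ : s ≫ pr₁ = 𝟙 E.left := by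
    change (lift (𝟙 E) (toUnit E ≫ η[E]) ≫ fst E E).left = _
    rw [lift_fst]
    rfl
  have hs₂ : s ≫ pr₂ = E.hom ≫ η[E].left := by
    change (lift (𝟙 E) (toUnit E ≫ η[E]) ≫ snd E E).left = _
    rw [lift_snd]
    rfl
  haveI : IsIso Φ := by
    haveI := Literature.AlgebraicGeometry.GroupSchemes.isIso_lift_fst_mul E
    change IsIso ((Over.forget _).map (lift (fst E E) μ[E]))
    infer_instance
  haveI : IsDominant Φ := inferInstance
  haveI : IsDominant μ' := by rw [← hΦ₂]; infer_instance
  -- ### the unit point `ε` and the points `s p = (p, ε)`, `Φ (s p) = (p, p)`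
  let ε : E.left := pr₂ (s (genericPoint E.left))
  have hpt : ∀ a b : ↥(Spec (CommRingCat.of K)), a = b :=
    fun a b => Subsingleton.elim (α := PrimeSpectrum K) _ _
  have hs₁p : ∀ p : E.left, pr₁ (s p) = p := fun p => by
    rw [← Scheme.Hom.comp_apply, hs₁]; rfl
  have hs₂p : ∀ p : E.left, pr₂ (s p) = ε := fun p => by
    change (s ≫ pr₂) p = (s ≫ pr₂) (genericPoint E.left)
    rw [hs₂, Scheme.Hom.comp_apply, Scheme.Hom.comp_apply, hpt (E.hom p) (E.hom (genericPoint E.left))]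
  have hμsp : ∀ p : E.left, μ' (s p) = p := fun p => by
    rw [← Scheme.Hom.comp_apply, hs]; rfl
  have hΦ₁p : ∀ q : Y, pr₁ (Φ q) = pr₁ q := fun q => by
    rw [← Scheme.Hom.comp_apply, hΦ₁]
  have hΦ₂p : ∀ q : Y, pr₂ (Φ q) = μ' q := fun q => by
    rw [← Scheme.Hom.comp_apply, hΦ₂]
  have hgen : ∀ (x : E.left) (V : E.left.Opens), x ∈ V → genericPoint E.left ∈ V :=
    fun x V hx => ((genericPoint_spec E.left).specializes (Set.mem_univ x)).mem_open V.2 hx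
  -- ### the chart at `ε` and the top form `θ₀ = d y₁ ∧ … ∧ d yₙ`
  obtain ⟨Vε, hVε, hεV, yε, bε, hbε⟩ := exists_affineChart_basis_eq_D E.hom n ε
  letI algε : Algebra K Γ(E.left, Vε) :=
    ((Scheme.ΓSpecIso (.of K)).inv ≫ E.hom.appLE ⊤ Vε le_top).hom.toAlgebra
  haveI : Nonempty Vε := ⟨⟨ε, hεV⟩⟩
  let y : Fin n → E.left.functionField := fun i => algebraMap Γ(E.left, Vε) _ (yε i)
  have halgε : algebraMap K E.left.functionField =
      (algebraMap Γ(E.left, Vε) E.left.functionField).comp (algebraMap K Γ(E.left, Vε)) := by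
    rw [hKL, ← germ_comp_appLE_eq_stalkHom E Vε (genericPoint E.left) (hgen ε Vε hεV)]
    rfl
  obtain ⟨B₀, hB₀⟩ := exists_basis_functionField_of_chart' n hVε bε hbε halgε
  -- ### the relative basis `d (pr₂♯ yᵢ)` of `Ω[K(Y)⁄K(E)]` (C5′) and the canonical cocycle `c₀`
  letI algLY : Algebra E.left.functionField Y.functionField := (functionFieldMap pr₁).toAlgebra
  have hLM : algebraMap E.left.functionField Y.functionField = functionFieldMap (fst E E).left := rfl
  obtain ⟨B₂, hB₂⟩ := exists_basis_kaehler_functionField_tensorObj E n hKL hLM B₀ hB₀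
  let c₀ : Y.functionField := B₂.det fun i =>
    KaehlerDifferential.D E.left.functionField _ (functionFieldMap Φ (functionFieldMap pr₂ (y i)))
  -- ### the cocycle at the points `s p`
  have perPoint : ∀ p : E.left, ∃ (v : Y.functionField) (zc : Fin n → E.left.presheaf.stalk p)
      (bc : letI := (stalkHom E p).toAlgebra
        Module.Basis (Fin n) (E.left.presheaf.stalk p) Ω[E.left.presheaf.stalk p⁄K])
      (Zc : Module.Basis (Fin n) E.left.functionField Ω[E.left.functionField⁄K]),
      (letI := (stalkHom E p).toAlgebra; ∀ i, bc i = KaehlerDifferential.D K _ (zc i)) ∧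
      (∀ i, Zc i = KaehlerDifferential.D K _ (toFunctionField p (zc i))) ∧
      IsUnitAt (s p) v ∧ c₀ = v * functionFieldMap μ' (Zc.det B₀) := by
    intro p
    -- the chart at `p`
    obtain ⟨Vp, hVp, hpV, yp, bp, hbp⟩ := exists_affineChart_basis_eq_D E.hom n p
    letI algp : Algebra K Γ(E.left, Vp) :=
      ((Scheme.ΓSpecIso (.of K)).inv ≫ E.hom.appLE ⊤ Vp le_top).hom.toAlgebra
    haveI : Nonempty Vp := ⟨⟨p, hpV⟩⟩
    have halgp : algebraMap K E.left.functionField =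
        (algebraMap Γ(E.left, Vp) E.left.functionField).comp (algebraMap K Γ(E.left, Vp)) := by
      rw [hKL, ← germ_comp_appLE_eq_stalkHom E Vp (genericPoint E.left) (hgen p Vp hpV)]
      rfl
    -- positions of `q = s p` and `Φ q`
    have hq₁ : pr₁ (s p) ∈ Vp := by rw [hs₁p]; exact hpV
    have hq₂ : pr₂ (s p) ∈ Vε := by rw [hs₂p]; exact hεV
    have hq'₁ : pr₁ (Φ (s p)) ∈ Vp := by rw [hΦ₁p, hs₁p]; exact hpV
    have hq'₂ : pr₂ (Φ (s p)) ∈ Vp := by rw [hΦ₂p, hμsp]; exact hpV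
    have hμq : μ' (s p) ∈ Vp := by rw [hμsp]; exact hpV
    -- `A := Γ(E, Vp)` acting through `pr₁`
    letI algAq : Algebra Γ(E.left, Vp) (Y.presheaf.stalk (s p)) :=
      ((pr₁.stalkMap (s p)).hom.comp (E.left.presheaf.germ Vp (pr₁ (s p)) hq₁).hom).toAlgebra
    letI algAq' : Algebra Γ(E.left, Vp) (Y.presheaf.stalk (Φ (s p))) :=
      ((pr₁.stalkMap (Φ (s p))).hom.comp (E.left.presheaf.germ Vp (pr₁ (Φ (s p))) hq'₁).hom).toAlgebra
    letI algAY : Algebra Γ(E.left, Vp) Y.functionField :=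
      ((functionFieldMap pr₁).comp (algebraMap Γ(E.left, Vp) E.left.functionField)).toAlgebra
    haveI : IsScalarTower Γ(E.left, Vp) (Y.presheaf.stalk (s p)) Y.functionField :=
      isScalarTower_stalk_functionField_of_algebraMap_eq pr₁ (s p) hq₁ rfl rfl
    haveI : IsScalarTower Γ(E.left, Vp) (Y.presheaf.stalk (Φ (s p))) Y.functionField :=
      isScalarTower_stalk_functionField_of_algebraMap_eq pr₁ (Φ (s p)) hq'₁ rfl rfl
    -- `K`-algebra structure on `𝒪_{E, μ' (s p)}`
    letI algKμ : Algebra K (E.left.presheaf.stalk (μ' (s p))) := (stalkHom E (μ' (s p))).toAlgebra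
    haveI : IsScalarTower K (E.left.presheaf.stalk (μ' (s p))) E.left.functionField :=
      IsScalarTower.of_algebraMap_eq' (by
        rw [hKL]
        exact (toFunctionField_comp_stalkHom E _).symm)
    -- the compatibilities of the structure maps
    have hA : (Φ.stalkMap (s p)).hom.comp (algebraMap Γ(E.left, Vp) (Y.presheaf.stalk (Φ (s p)))) =
        algebraMap Γ(E.left, Vp) (Y.presheaf.stalk (s p)) :=
      stalkMap_comp_stalkMap_comp_germ_of_comp_eq Φ pr₁ hΦ₁ Vp (s p) hq₁ hq'₁
    have hσA : (functionFieldMap Φ).comp (algebraMap Γ(E.left, Vp) Y.functionField) =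
        algebraMap Γ(E.left, Vp) Y.functionField := by
      change (functionFieldMap Φ).comp ((functionFieldMap pr₁).comp _) = (functionFieldMap pr₁).comp _
      rw [← RingHom.comp_assoc, ← functionFieldMap_comp pr₁ Φ, functionFieldMap_congr hΦ₁]
    have hφ₂ : (functionFieldMap pr₂).comp (algebraMap K E.left.functionField) =
        (algebraMap Γ(E.left, Vp) Y.functionField).comp (algebraMap K Γ(E.left, Vp)) := by
      change _ = ((functionFieldMap pr₁).comp (algebraMap Γ(E.left, Vp) E.left.functionField)).comp _
      rw [RingHom.comp_assoc, ← halgp, hKL]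
      exact (functionFieldMap_comp_stalkHom (snd E E)).trans
        (functionFieldMap_comp_stalkHom (fst E E)).symm
    -- coordinates at `μ' (s p) = p` and at `p`: germs of the chart sections `yp`
    obtain ⟨bzp, hbzp⟩ := exists_basis_stalk_of_chart' n hVp bp hbp hμq
      (by exact (germ_comp_appLE_eq_stalkHom E Vp _ hμq).symm)
    obtain ⟨Zp, hZp⟩ := exists_basis_functionField_of_chart' n hVp bp hbp halgp
    have hZpμ : ∀ i, Zp i = KaehlerDifferential.D K _
        (toFunctionField (μ' (s p)) (E.left.presheaf.germ Vp (μ' (s p)) hμq (yp i))) := fun i => by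
      rw [hZp i, toFunctionField_germ]
      rfl
    letI algKp : Algebra K (E.left.presheaf.stalk p) := (stalkHom E p).toAlgebra
    obtain ⟨bcp, hbcp⟩ := exists_basis_stalk_of_chart' n hVp bp hbp hpV
      (by exact (germ_comp_appLE_eq_stalkHom E Vp _ hpV).symm)
    have hZpp : ∀ i, Zp i = KaehlerDifferential.D K _
        (toFunctionField p (E.left.presheaf.germ Vp p hpV (yp i))) := fun i => by
      rw [hZp i, toFunctionField_germ]
      rfl
    -- relative coordinates at `s p` (chart `Vε`) and at `Φ (s p)` (chart `Vp`) from the product chart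
    obtain ⟨bw, hbw⟩ :=
      exists_basis_stalk_tensorObj_eq_D E E hVp hVε rfl rfl bε hbε (s p) hq₁ hq₂ rfl
    obtain ⟨W, hW⟩ := exists_basis_functionField_of_localCoordinates' n Γ(E.left, Vp) bw hbw
    obtain ⟨bw', hbw'⟩ :=
      exists_basis_stalk_tensorObj_eq_D E E hVp hVp rfl rfl bp hbp (Φ (s p)) hq'₁ hq'₂ rfl
    obtain ⟨W', hW'⟩ := exists_basis_functionField_of_localCoordinates' n Γ(E.left, Vp) bw' hbw'
    have hW'z : ∀ i, toFunctionField (Φ (s p))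
        (pr₂.stalkMap (Φ (s p)) (E.left.presheaf.germ Vp (pr₂ (Φ (s p))) hq'₂ (yp i))) =
        functionFieldMap pr₂
          (toFunctionField (μ' (s p)) (E.left.presheaf.germ Vp (μ' (s p)) hμq (yp i))) := fun i => by
      rw [toFunctionField_stalkMap_germ pr₂ (Φ (s p)) hq'₂ (yp i), toFunctionField_germ]
      rfl
    -- the cocycle factorisation at `q = s p`
    obtain ⟨v, hv, hdet⟩ := det_shearCocycle_eq_mul Φ pr₂ μ' n K Γ(E.left, Vp)
      (algebraMap K Γ(E.left, Vp)) (s p) hΦ₂ hA hσA hφ₂ bzp hbzp Zp hZpμ B₀ hB₀ bw hbw W hW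
      bw' hbw' W' hW' hW'z
    -- base conversion `Γ(E, Vp) → K(E)`: the left-hand side is the canonical cocycle `c₀`
    have hWy : ∀ i, W i = KaehlerDifferential.D Γ(E.left, Vp) _ (functionFieldMap pr₂ (y i)) :=
      fun i => by rw [hW i, toFunctionField_stalkMap_germ pr₂ (s p) hq₂ (yε i)]
    have hB₂' : ∀ i, B₂ i = KaehlerDifferential.D E.left.functionField _
        (RingHom.id Y.functionField (functionFieldMap pr₂ (y i))) := fun i => by
      rw [hB₂ i]; rfl
    have hconv := det_D_ringHom_eq (algebraMap Γ(E.left, Vp) E.left.functionField)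
      (RingHom.id Y.functionField) rfl W hWy B₂ hB₂'
      (fun j => functionFieldMap Φ (functionFieldMap pr₂ (y j)))
    refine ⟨v, fun i => E.left.presheaf.germ Vp p hpV (yp i), bcp, Zp, hbcp, hZpp, hv, ?_⟩
    rw [← hdet]
    exact hconv
  -- ### the normalising function `g₀ = s♯ (c₀)` and the frame `θ₀ / g₀`
  obtain ⟨vη, zη, bη, Zη, -, -, hvη, hcη⟩ := perPoint (genericPoint E.left)
  have hreg : IsRegularAt (s (genericPoint E.left)) c₀ := by
    rw [hcη]
    refine hvη.isRegularAt.mul (IsRegularAt.functionFieldMap (f := μ') ?_)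
    rw [hμsp]
    exact isRegularAt_genericPoint _
  obtain ⟨t, ht⟩ := hreg
  refine ⟨(s.stalkMap (genericPoint E.left) t)⁻¹, y, B₀, hB₀, ?_⟩
  intro p z b hb B hB
  obtain ⟨v, zc, bc, Zc, hbc, hZc, hv, hc⟩ := perPoint p
  have hJ : Zc.det B₀ ≠ 0 := (Zc.isUnit_det B₀).ne_zero
  have hframe : IsUnitAt p ((s.stalkMap (genericPoint E.left) t)⁻¹ * Zc.det B₀) :=
    isUnitAt_inv_stalkMap_mul s μ' hs hc hv hJ t ht
  letI := (stalkHom E p).toAlgebra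
  haveI : IsScalarTower K (E.left.presheaf.stalk p) E.left.functionField :=
    IsScalarTower.of_algebraMap_eq' (by
      rw [hKL]
      exact (toFunctionField_comp_stalkHom E p).symm)
  exact (isUnitAt_mul_det_iff_of_localCoordinates' n K bc hbc b hb hZc hB _ B₀).1 hframe

end GroupScheme

end Literature.AlgebraicGeometry.Motives

end
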